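import Summits.HodgeConjecture.CorCM.Census.TwistGenerationResidual
import Summits.HodgeConjecture.CorCM.Census.TwistGenerationCover

/-!
# Uniform twist generation, XIII: THE UNIFORM SHIFT IDENTITY `θ_{cst (a+1)}[Φ] − θ_{cst a}[Φ] ≡ −wplus a` and the base change of star forms

COR-CM (cell `pub-hodgecm2`), count-neutral kernel combinatorics by the binder seat b09 (gen 37; lane UNIFORM TWIST GENERATION, part XIII), on
parts I–II and V (`thetaG_typeSum_single`; `cst`, `catom`, `trans`, `wplus`; the transfer chain `single_oflipCM_cst_sub_mem`, the pairs of centres and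
canonical atoms) used BY NAME.  Theorems only: no definition, no `decide`, no certificate, no named fact, no `sorry`.
HONEST FRAMING: `HC_CM` is NOT proved, here or anywhere in the tree; nothing here is a period or a headline.

Along a datum `θ : G ≃ ℤ/2n × B` (`θ (PQ) = θ P + θ Q`, `θ c = (n, 0)`):
* §1 **base change of star forms** (`mapDomain_rt_thetaG`): `(θ_{T₀}(typeSum [Φ]))·Q⁻¹ = θ_{T₀·Q⁻¹}(typeSum [Φ·Q⁻¹])` — the star form about a
  centre translates to the star form about the translated centre (used in part XV on the screw type, which is its own translate);
* §2 the centre as a `range n × B`-indexed family (`sum_cst_eq_sum_range`) and the star form in `θ`-apply shape (`thetaG_cst_typeSum_single_eq`);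
* §3 **THE UNIFORM SHIFT IDENTITY** (`thetaG_succ_sub_thetaG_add_wplus_mem`): for EVERY type `Φ` and EVERY centre `a`, if `ℤ⟨pairs⟩ ≤ L` and `L`
  holds the interior transfers, then `θ_{cst (a+1)}(typeSum [Φ]) − θ_{cst a}(typeSum [Φ]) + wplus a ∈ L` — the level-`n` form of the quartic
  shift identity `A_{u+1}(s) − A_u(s) ≡ w_{u+1}` (`Census/QuarticTwistScrew.affine_succ_sub_affine_mem`) and of the octic `cst_tens_shift_mem`.
  PROOF: by the transfer chain every atom-minus-centre vector `[cst a'^{(t)}] − [cst a']` is the canonical one `[catom y b] − [cst y]`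
  (`θ t = (y, b)`) modulo `L`; the two stars then differ only in the rows `a` (in `cst a`, not in `cst (a+1)`) and `a + n` (conversely), read
  with the complementary indicators `1_Φ(θ⁻¹(a+n, b)) = 1 − 1_Φ(θ⁻¹(a, b))`, and `[catom (a+n) b] − [cst (a+n)] ≡ −([catom a b] − [cst a])`
  modulo pairs; what is left is `−Σ_b ([catom a b] − [cst a]) − [cst a] + [cst (a+1)] = −wplus a`.

## References
* [Pohlmann1968] H. Pohlmann, Algebraic cycles on abelian varieties of complex multiplication type, Ann. of Math. 88 (1968), Thm 1.
* [Milne1999] J. S. Milne, Lefschetz motives and the Tate conjecture, Compositio Math. 117 (1999), Prop. 2.1, p. 54.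
-/

namespace Summit.HodgeConjecture.CorCM.Census.TwistGeneration

open Finset
open Summit.HodgeConjecture.CorCM.Prior.AllgGroup.RfwfAllgGroup
open Summit.HodgeConjecture.CorCM.Census.BlockParity
open Summit.HodgeConjecture.CorCM.Census.Coinvariant

noncomputable section

variable {G : Type*} [Group G] [Fintype G] [DecidableEq G] {c : G}

/-! ## §1 Base change of star forms -/

/-- **Base change of a star form**: `(θ_{T₀}(typeSum [Φ]))·Q⁻¹ = θ_{T₀·Q⁻¹}(typeSum [Φ·Q⁻¹])`. [folklore] -/
theorem mapDomain_rt_thetaG (hc2 : c * c = 1) (Q : G) (T₀ Φ : CMF G c) :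
    Finsupp.mapDomain (rt c Q) (thetaG c hc2 T₀ (typeSum G c (Finsupp.single Φ 1))) =
      thetaG c hc2 (rt c Q T₀) (typeSum G c (Finsupp.single (rt c Q Φ) 1)) := by
  rw [thetaG_typeSum_single, thetaG_typeSum_single, Finsupp.mapDomain_add, Finsupp.mapDomain_finsetSum]
  simp only [Finsupp.mapDomain_sub, Finsupp.mapDomain_single, rt_oflipCM]
  have himg : (rt c Q T₀).1 \ (rt c Q Φ).1 = (T₀.1 \ Φ.1).image (fun t => t * Q⁻¹) := by
    ext P
    rw [mem_sdiff_rt_iff, mem_image]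
    constructor
    · intro h; exact ⟨P * Q, h, by rw [mul_inv_cancel_right]⟩
    · rintro ⟨t, ht, rfl⟩; rw [inv_mul_cancel_right]; exact ht
  rw [himg, sum_image fun t _ t' _ h => mul_right_cancel h]

/-! ## §2 The centre as a `range n × B`-indexed family -/

variable {B : Type} [AddGroup B]
variable {n : ℕ} [NeZero n] (θ : G ≃ ZMod (2 * n) × B)
variable (hθ : ∀ P Q : G, θ (P * Q) = θ P + θ Q) (hθc : θ c = (((n : ℕ) : ZMod (2 * n)), 0))

section Indexed

variable [Fintype B]

/-- **The centre is indexed by `range n × B`**: `cst a = {θ⁻¹(a + i, b) : i < n, b ∈ B}`. [folklore] -/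
theorem cst_eq_image (a : ZMod (2 * n)) :
    (cst θ hθ hθc a).1 = ((range n) ×ˢ (univ : Finset B)).image (fun ib : ℕ × B => θ.symm (a + (ib.1 : ℕ), ib.2)) := by
  have h2n : n < 2 * n := by have := NeZero.ne n; omega
  ext P
  rw [mem_cst, mem_image]
  constructor
  · intro hP
    refine ⟨(((θ P).1 - a).val, (θ P).2), mem_product.mpr ⟨mem_range.mpr hP, mem_univ _⟩, ?_⟩
    show θ.symm (a + ((((θ P).1 - a).val : ℕ) : ZMod (2 * n)), (θ P).2) = P
    rw [ZMod.natCast_zmod_val, add_sub_cancel, Prod.mk.eta, Equiv.symm_apply_apply]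
  · rintro ⟨⟨i, b⟩, hib, rfl⟩
    have hi : i < n := mem_range.mp (mem_product.mp hib).1
    rw [Equiv.apply_symm_apply, add_sub_cancel_left, ZMod.val_cast_of_lt (by omega)]
    exact hi

/-- **Sums over a centre** are double sums over rows `a + i` (`i < n`) and columns. [folklore] -/
theorem sum_cst_eq_sum_range {M : Type*} [AddCommMonoid M] (a : ZMod (2 * n)) (g : G → M) :
    ∑ t ∈ (cst θ hθ hθc a).1, g t = ∑ i ∈ range n, ∑ b : B, g (θ.symm (a + (i : ℕ), b)) := by
  have h2n : n < 2 * n := by have := NeZero.ne n; omega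
  rw [cst_eq_image θ hθ hθc a, sum_image, sum_product]
  rintro ⟨i, b⟩ hib ⟨i', b'⟩ hib' h
  have hi : i < n := mem_range.mp (mem_product.mp hib).1
  have hi' : i' < n := mem_range.mp (mem_product.mp hib').1
  have h' := θ.symm.injective h
  simp only [Prod.mk.injEq, add_right_inj] at h'
  obtain ⟨h1, h2⟩ := h'
  have h3 := congrArg ZMod.val h1
  rw [ZMod.val_cast_of_lt (by omega), ZMod.val_cast_of_lt (by omega)] at h3
  rw [h3, h2]

end Indexed

/-- **The star form in `θ`-apply shape**: `θ_{cst a}(typeSum [Φ]) = Σ_{t ∈ cst a} 1_Φ(c t) • ([cst a^{(t)}] − [cst a]) + [cst a]`. [folklore] -/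
theorem thetaG_cst_typeSum_single_eq (hc2 : c * c = 1) (a : ZMod (2 * n)) (Φ : CMF G c) :
    thetaG c hc2 (cst θ hθ hθc a) (typeSum G c (Finsupp.single Φ 1)) =
      (∑ t ∈ (cst θ hθ hθc a).1, indG Φ.1 (c * t) • (Finsupp.single (oflipCM c hc2 t (cst θ hθ hθc a)) 1 - Finsupp.single (cst θ hθ hθc a) 1))
        + Finsupp.single (cst θ hθ hθc a) 1 := by
  rw [typeSum_single, thetaG_apply, indG_pair c Φ 1, one_smul]

/-! ## §3 The uniform shift identity -/

section Shift

variable [Fintype B]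

omit [Fintype G] [DecidableEq G] [NeZero n] in
/-- **Telescoping of shifted row sums**: `Σ_{i<n} f (a+1+i) − Σ_{i<n} f (a+i) = f (a+n) − f a`. [folklore] -/
theorem sum_range_shift_sub {M : Type*} [AddCommGroup M] (f : ZMod (2 * n) → M) (a : ZMod (2 * n)) :
    ∑ i ∈ range n, f (a + 1 + (i : ℕ)) - ∑ i ∈ range n, f (a + (i : ℕ)) = f (a + (n : ℕ)) - f a := by
  have hshift : ∑ i ∈ range n, f (a + 1 + (i : ℕ)) = ∑ i ∈ range n, f (a + ((i + 1 : ℕ) : ℕ)) :=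
    sum_congr rfl fun i _ => by push_cast; ring_nf
  have htel : (∑ i ∈ range n, f (a + ((i + 1 : ℕ) : ℕ))) + f (a + ((0 : ℕ) : ℕ)) =
      (∑ i ∈ range n, f (a + (i : ℕ))) + f (a + (n : ℕ)) := by
    rw [← sum_range_succ' (fun i => f (a + (i : ℕ))), sum_range_succ]
  rw [Nat.cast_zero, add_zero] at htel
  rw [hshift]
  exact sub_eq_sub_iff_add_eq_add.mpr (by rw [htel, add_comm])

/-- The star sum about `cst a` reduces, modulo the transfers, to the row sums of CANONICAL atom-minus-centre vectors weighted by the complementary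
indicator: `θ_{cst a}[Φ] − [cst a] − Σ_{i<n} Σ_b 1_Φ(c·θ⁻¹(a+i, b)) • ([catom (a+i) b] − [cst (a+i)]) ∈ L`. [folklore] -/
theorem thetaG_cst_sub_mem (hc2 : c * c = 1) (L : Submodule ℤ (CMF G c →₀ ℤ))
    (hT : ∀ (a x : ZMod (2 * n)) (b : B), 1 ≤ (x - a).val → (x - a).val < n → trans θ hθ hθc hc2 a x b ∈ L)
    (a : ZMod (2 * n)) (Φ : CMF G c) :
    thetaG c hc2 (cst θ hθ hθc a) (typeSum G c (Finsupp.single Φ 1)) - Finsupp.single (cst θ hθ hθc a) 1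
      - ∑ i ∈ range n, ∑ b : B, indG Φ.1 (c * θ.symm (a + (i : ℕ), b)) •
          (Finsupp.single (catom θ hθ hθc hc2 (a + (i : ℕ)) b) 1 - Finsupp.single (cst θ hθ hθc (a + (i : ℕ))) 1) ∈ L := by
  have h2n : n < 2 * n := by have := NeZero.ne n; omega
  rw [thetaG_cst_typeSum_single_eq, add_sub_cancel_right, sum_cst_eq_sum_range θ hθ hθc a, ← sum_sub_distrib]
  refine Submodule.sum_mem _ fun i hi => ?_
  have hi' : i < n := mem_range.mp hi
  rw [← sum_sub_distrib]
  refine Submodule.sum_mem _ fun b _ => ?_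
  rw [← smul_sub]
  refine Submodule.smul_mem _ _ ?_
  exact single_oflipCM_cst_sub_mem θ hθ hθc hc2 L hT i a (a + (i : ℕ)) b
    (by rw [add_sub_cancel_left, ZMod.val_cast_of_lt (by omega)]) hi'

/-- **The boundary rows modulo pairs**: the row `a + n` read with the complementary indicator, minus the row `a`, plus the full column sum of
canonical atom-minus-centre vectors at `a` is a sum of pairs. [folklore] -/
theorem boundary_rows_mem (hc2 : c * c = 1) (L : Submodule ℤ (CMF G c →₀ ℤ)) (hP : Submodule.span ℤ (pairSet c) ≤ L)
    (a : ZMod (2 * n)) (Φ : CMF G c) :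
    (∑ b : B, indG Φ.1 (c * θ.symm (a + (n : ℕ), b)) •
        (Finsupp.single (catom θ hθ hθc hc2 (a + (n : ℕ)) b) 1 - Finsupp.single (cst θ hθ hθc (a + (n : ℕ))) 1))
      - (∑ b : B, indG Φ.1 (c * θ.symm (a, b)) • (Finsupp.single (catom θ hθ hθc hc2 a b) 1 - Finsupp.single (cst θ hθ hθc a) 1))
      + ∑ b : B, (Finsupp.single (catom θ hθ hθc hc2 a b) 1 - Finsupp.single (cst θ hθ hθc a) 1) ∈ L := by
  rw [← sum_sub_distrib, ← sum_add_distrib]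
  refine Submodule.sum_mem _ fun b _ => ?_
  have e1 : c * θ.symm (a + (n : ℕ), b) = θ.symm (a, b) := by rw [c_mul_symm θ hθ hθc, add_assoc, n_add_n, add_zero]
  have e2 : indG Φ.1 (c * θ.symm (a, b)) = 1 - indG Φ.1 (θ.symm (a, b)) := by
    rw [← indG_pair c Φ (θ.symm (a, b))]; ring
  rw [e1, e2]
  have e3 : indG Φ.1 (θ.symm (a, b)) •
        (Finsupp.single (catom θ hθ hθc hc2 (a + (n : ℕ)) b) (1 : ℤ) - Finsupp.single (cst θ hθ hθc (a + (n : ℕ))) 1)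
      - (1 - indG Φ.1 (θ.symm (a, b))) • (Finsupp.single (catom θ hθ hθc hc2 a b) (1 : ℤ) - Finsupp.single (cst θ hθ hθc a) 1)
      + (Finsupp.single (catom θ hθ hθc hc2 a b) (1 : ℤ) - Finsupp.single (cst θ hθ hθc a) 1) =
      indG Φ.1 (θ.symm (a, b)) •
        ((Finsupp.single (catom θ hθ hθc hc2 a b) (1 : ℤ) + Finsupp.single (catom θ hθ hθc hc2 (a + (n : ℕ)) b) 1)
          - (Finsupp.single (cst θ hθ hθc a) 1 + Finsupp.single (cst θ hθ hθc (a + (n : ℕ))) 1)) := by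
    simp only [sub_smul, one_smul, smul_sub, smul_add]; abel
  rw [e3]
  exact Submodule.smul_mem _ _ (hP (Submodule.sub_mem _ (single_catom_add_mem_span_pairSet θ hθ hθc hc2 a b)
    (single_cst_add_mem_span_pairSet θ hθ hθc a)))

/-- **THE UNIFORM SHIFT IDENTITY.**  If `ℤ⟨pairs⟩ ≤ L` and `L` holds the interior transfers, then for every centre `a` and EVERY type `Φ`
`θ_{cst (a+1)}(typeSum [Φ]) − θ_{cst a}(typeSum [Φ]) + wplus a ∈ L`. [folklore] -/
theorem thetaG_succ_sub_thetaG_add_wplus_mem (hc2 : c * c = 1) (L : Submodule ℤ (CMF G c →₀ ℤ))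
    (hP : Submodule.span ℤ (pairSet c) ≤ L)
    (hT : ∀ (a x : ZMod (2 * n)) (b : B), 1 ≤ (x - a).val → (x - a).val < n → trans θ hθ hθc hc2 a x b ∈ L)
    (a : ZMod (2 * n)) (Φ : CMF G c) :
    thetaG c hc2 (cst θ hθ hθc (a + 1)) (typeSum G c (Finsupp.single Φ 1))
      - thetaG c hc2 (cst θ hθ hθc a) (typeSum G c (Finsupp.single Φ 1)) + wplus θ hθ hθc hc2 a ∈ L := by
  have hA0 := thetaG_cst_sub_mem θ hθ hθc hc2 L hT a Φ
  have hA1 := thetaG_cst_sub_mem θ hθ hθc hc2 L hT (a + 1) Φ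
  have hbd := boundary_rows_mem θ hθ hθc hc2 L hP a Φ
  have hsh := sum_range_shift_sub (fun y => ∑ b : B, indG Φ.1 (c * θ.symm (y, b)) •
      (Finsupp.single (catom θ hθ hθc hc2 y b) (1 : ℤ) - Finsupp.single (cst θ hθ hθc y) 1)) a
  -- the upper star in terms of the column sum
  have hw : wplus θ hθ hθc hc2 a = (∑ b : B, (Finsupp.single (catom θ hθ hθc hc2 a b) 1 - Finsupp.single (cst θ hθ hθc a) 1))
      + Finsupp.single (cst θ hθ hθc a) 1 - Finsupp.single (cst θ hθ hθc (a + 1)) 1 := by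
    rw [wplus, sum_sub_distrib, sum_const, card_univ, sub_smul, one_smul, ← natCast_zsmul]
    abel
  have e : thetaG c hc2 (cst θ hθ hθc (a + 1)) (typeSum G c (Finsupp.single Φ 1))
      - thetaG c hc2 (cst θ hθ hθc a) (typeSum G c (Finsupp.single Φ 1)) + wplus θ hθ hθc hc2 a =
      (thetaG c hc2 (cst θ hθ hθc (a + 1)) (typeSum G c (Finsupp.single Φ 1)) - Finsupp.single (cst θ hθ hθc (a + 1)) 1
        - ∑ i ∈ range n, ∑ b : B, indG Φ.1 (c * θ.symm (a + 1 + (i : ℕ), b)) •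
            (Finsupp.single (catom θ hθ hθc hc2 (a + 1 + (i : ℕ)) b) 1 - Finsupp.single (cst θ hθ hθc (a + 1 + (i : ℕ))) 1))
      - (thetaG c hc2 (cst θ hθ hθc a) (typeSum G c (Finsupp.single Φ 1)) - Finsupp.single (cst θ hθ hθc a) 1
        - ∑ i ∈ range n, ∑ b : B, indG Φ.1 (c * θ.symm (a + (i : ℕ), b)) •
            (Finsupp.single (catom θ hθ hθc hc2 (a + (i : ℕ)) b) 1 - Finsupp.single (cst θ hθ hθc (a + (i : ℕ))) 1))
      + ((∑ b : B, indG Φ.1 (c * θ.symm (a + (n : ℕ), b)) •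
            (Finsupp.single (catom θ hθ hθc hc2 (a + (n : ℕ)) b) 1 - Finsupp.single (cst θ hθ hθc (a + (n : ℕ))) 1))
          - (∑ b : B, indG Φ.1 (c * θ.symm (a, b)) • (Finsupp.single (catom θ hθ hθc hc2 a b) 1 - Finsupp.single (cst θ hθ hθc a) 1))
          + ∑ b : B, (Finsupp.single (catom θ hθ hθc hc2 a b) 1 - Finsupp.single (cst θ hθ hθc a) 1)) := by
    rw [hw, ← hsh]; abel
  rw [e]
  exact Submodule.add_mem _ (Submodule.sub_mem _ hA1 hA0) hbd

end Shift

end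

end Summit.HodgeConjecture.CorCM.Census.TwistGeneration
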